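import Mathlib
import Summits.ValiantsHypothesis.ValiantsHypothesis.Theorems.LacunarySymmetroidMatrixDescartesCensusRealExponentsThreeByThree
import Summits.ValiantsHypothesis.ValiantsHypothesis.Theorems.LacunarySymmetroidMatrixDescartesCensusConfluentClosureChain

/-!
# `MatrixDescartes` census — refuting a `PosRootLawAt m K B` row by ONE alternating chain (plain real-exponent pencils, `m = 2, 3`)

HONEST FRAMING.  Object-search cell `pub-symmetroid`; registers `ζ_sym(2,K)`, `ζ_sym(3,K)` = statements `PosRootLawAt m K B`
(door A = `PosRootLawAt 2 6 19`, stmt-ValiantsHypothesis-19979; `(3,4)` companion = `PosRootLawAt 3 4 18`, stmt-19980).  This file is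
the certificate INTERFACE a refuter wants for an ORDINARY (non-confluent) real-exponent pencil: the tree's negation currency
`not_posRootLawAt_two_iff` / `not_posRootLawAt_three_iff` counts zeros (`Set.ncard`), the tree's `le_ncard_of_brackets` wants pairwise
DISJOINT brackets; here ONE strictly increasing chain of `B + 2` abscissae `p₀ < ⋯ < p_{B+1}` (in `t = log x`) with strictly alternating
determinant values suffices (`Confluent.le_ncard_of_chain`).  Nothing is decided; no pencil is claimed; no register moves; nothing
on `MatrixDescartes` (stmt-18050) or `VP ≠ VNP`.

* `not_posRootLawAt_two_of_chain` — `2 × 2`: symmetric letters `S : Fin K → _`, real exponents `δ`, chain `p : Fin (B+2) → ℝ` with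
  `det(∑ e^{δ_l p_i} S_l) · det(∑ e^{δ_l p_{i+1}} S_l) < 0` for all `i` ⇒ `¬ PosRootLawAt 2 K B`;
* `not_posRootLawAt_three_of_chain` — the `3 × 3` twin;
* `not_doorA26_of_chain`, `not_doorA34_of_chain` — the two doors by name.

[folklore] Elementary repackaging (IVT on consecutive gaps + the tree's real-exponent transfer).
-/

-- `Summit.ValiantsHypothesis.ValiantsHypothesis.…` repeats a component by the D-0017 layout
-- (single-conjunct summit), which the `dupNamespace` linter flags; the name is mandated.
set_option linter.dupNamespace false

namespace Summit.ValiantsHypothesis.ValiantsHypothesis.Theorems.LacunarySymmetroidMatrixDescartes.Census.RealExp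

open scoped BigOperators Matrix
open Summit.ValiantsHypothesis.ValiantsHypothesis.Theorems.MatrixDescartes.Negative (PosRootLawAt)
open Summit.ValiantsHypothesis.ValiantsHypothesis.Theorems.LacunarySymmetroidMatrixDescartes.Census.RealExp.Confluent (le_ncard_of_chain)

/-- **Chain refutation, `2 × 2`**: a real-exponent symmetric pencil whose determinant alternates strictly in sign along `B + 2` strictly
increasing abscissae (variable `t = log x`) refutes `PosRootLawAt 2 K B`. [folklore] -/
theorem not_posRootLawAt_two_of_chain {K B : ℕ} (δ : Fin K → ℝ) (S : Fin K → Matrix (Fin 2) (Fin 2) ℝ)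
    (hS : ∀ l, (S l).IsSymm) (p : Fin (B + 2) → ℝ) (hp : StrictMono p)
    (hsign : ∀ i : Fin (B + 1), (∑ l, Real.exp (δ l * p i.castSucc) • S l).det *
      (∑ l, Real.exp (δ l * p i.succ) • S l).det < 0) :
    ¬ PosRootLawAt 2 K B := by
  have hcount := (le_ncard_of_chain δ S (Nat.succ_pos B) p hp hsign).2
  rw [← ncard_rpow_eq_ncard_exp δ S] at hcount
  exact (not_posRootLawAt_two_iff K B).mpr ⟨δ, S, hS, hcount⟩

/-- **Chain refutation, `3 × 3`**: the same for `3 × 3` symmetric letters ⇒ `¬ PosRootLawAt 3 K B`. [folklore] -/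
theorem not_posRootLawAt_three_of_chain {K B : ℕ} (δ : Fin K → ℝ) (S : Fin K → Matrix (Fin 3) (Fin 3) ℝ)
    (hS : ∀ l, (S l).IsSymm) (p : Fin (B + 2) → ℝ) (hp : StrictMono p)
    (hsign : ∀ i : Fin (B + 1), (∑ l, Real.exp (δ l * p i.castSucc) • S l).det *
      (∑ l, Real.exp (δ l * p i.succ) • S l).det < 0) :
    ¬ PosRootLawAt 3 K B := by
  have hcount := (le_ncard_of_chain δ S (Nat.succ_pos B) p hp hsign).2
  rw [← ncard_rpow_eq_ncard_exp δ S] at hcount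
  exact (not_posRootLawAt_three_iff K B).mpr ⟨δ, S, hS, hcount⟩

/-- **Door A by one chain**: six symmetric `2 × 2` letters on real exponents with `21` strictly alternating determinant values along a
strictly increasing chain refute `Theses.LacunarySymmetroid.DoorA26`.  No such pencil is claimed; the door stays OPEN. [folklore] -/
theorem not_doorA26_of_chain (δ : Fin 6 → ℝ) (S : Fin 6 → Matrix (Fin 2) (Fin 2) ℝ) (hS : ∀ l, (S l).IsSymm)
    (p : Fin 21 → ℝ) (hp : StrictMono p)
    (hsign : ∀ i : Fin 20, (∑ l, Real.exp (δ l * p i.castSucc) • S l).det *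
      (∑ l, Real.exp (δ l * p i.succ) • S l).det < 0) :
    ¬ Summit.ValiantsHypothesis.ValiantsHypothesis.Theses.LacunarySymmetroid.DoorA26 := fun hD =>
  not_posRootLawAt_two_of_chain δ S hS p hp hsign fun d T hT => hD d T hT

/-- **Door `(3,4)` by one chain**: four symmetric `3 × 3` letters on real exponents with `20` strictly alternating determinant values
refute `Theses.LacunarySymmetroid.DoorA34`.  No such pencil is claimed; the door stays OPEN. [folklore] -/
theorem not_doorA34_of_chain (δ : Fin 4 → ℝ) (S : Fin 4 → Matrix (Fin 3) (Fin 3) ℝ) (hS : ∀ l, (S l).IsSymm)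
    (p : Fin 20 → ℝ) (hp : StrictMono p)
    (hsign : ∀ i : Fin 19, (∑ l, Real.exp (δ l * p i.castSucc) • S l).det *
      (∑ l, Real.exp (δ l * p i.succ) • S l).det < 0) :
    ¬ Summit.ValiantsHypothesis.ValiantsHypothesis.Theses.LacunarySymmetroid.DoorA34 := fun hD =>
  not_posRootLawAt_three_of_chain δ S hS p hp hsign fun d T hT => hD d T hT

end Summit.ValiantsHypothesis.ValiantsHypothesis.Theorems.LacunarySymmetroidMatrixDescartes.Census.RealExp
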